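/- Free-seat work of EXTRA WIDTH SEAT `ym-line-cbag-p1-w5` (prover-ym-line-cbag-p1-w5-g2-0), route `EguchiKawaiDirectionLadder`
(ideator ym-idea-2, LINE 8), crux `TripleSmallBallMargin` (stmt-QuantumFields-27724), LEAD g24's v7 architecture, stub S6 (GrNet): the two
objects of the GRASSMANNIAN NET — the coordinate projection `headProj r s` of rank `r` in dimension `r + s` and the block-diagonal embedding
`blockDiag₂ : U(r) × U(s) → U(r+s)` (its stabiliser).  Definitions only; the net itself (`#𝒩 ≤ C^{N²} ρ^{−2rs}`, every conjugate `U·headProj·U⋆`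
within `ρ` of some `V·headProj·V⋆`, `V ∈ 𝒩`) is proved in `EguchiKawaiDirectionLadderGrassmannianNet.lean`.  Route-independent.  Nothing here
bears on the Yang–Mills mass gap (barrier-ledger line onto `EguchiKawaiBreakdown`). -/
import Literature.Barriers.QuantumFields.UnitaryHaarSmallBallUpper
import HarnessLib

/-!
# Route `EguchiKawaiDirectionLadder`, stub S6 (Grassmannian net): objects

* `headProj r s` — the orthogonal projection of `ℂ^{r+s}` onto the first `r` coordinates, as the matrix
  `reindex finSumFinEquiv finSumFinEquiv (fromBlocks 1 0 0 0)`; the rank-`r` Grassmannian of `ℂ^{r+s}` is its `U(r+s)`-conjugation orbit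
  `{U · headProj · U⋆}`.
* `blockDiag₂ A B` — the block-diagonal unitary `reindex (fromBlocks A 0 0 B) ∈ U(r+s)` for `A ∈ U(r)`, `B ∈ U(s)`; these fix `headProj` under
  conjugation (the stabiliser `U(r) × U(s)` of the base point of the Grassmannian).
-/

set_option autoImplicit false

noncomputable section

open scoped Matrix

namespace Summit.QuantumFields.YangMills.Theorems.EguchiKawaiDirectionLadder

/-- The coordinate projection of rank `r` in dimension `r + s`: `diag(1,…,1,0,…,0)` written as the reindexed block matrix
`fromBlocks 1 0 0 0` along `finSumFinEquiv : Fin r ⊕ Fin s ≃ Fin (r + s)`.  Object of stub S6 (Grassmannian net) of the v7 architecture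
of stmt-QuantumFields-27724. -/
def headProj (r s : ℕ) : Matrix (Fin (r + s)) (Fin (r + s)) ℂ :=
  Matrix.reindex finSumFinEquiv finSumFinEquiv (Matrix.fromBlocks 1 0 0 0)

/-- The block-diagonal matrix `fromBlocks A 0 0 B`, reindexed to `Fin (r + s)`, is unitary for unitary `A`, `B`. -/
theorem reindex_fromBlocks_mem_unitaryGroup {r s : ℕ} (A : Matrix.unitaryGroup (Fin r) ℂ)
    (B : Matrix.unitaryGroup (Fin s) ℂ) :
    Matrix.reindex finSumFinEquiv finSumFinEquiv
        (Matrix.fromBlocks (A : Matrix (Fin r) (Fin r) ℂ) 0 0 (B : Matrix (Fin s) (Fin s) ℂ)) ∈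
      Matrix.unitaryGroup (Fin (r + s)) ℂ := by
  rw [Matrix.mem_unitaryGroup_iff, Matrix.star_eq_conjTranspose]
  have hA : (A : Matrix (Fin r) (Fin r) ℂ) * (A : Matrix (Fin r) (Fin r) ℂ)ᴴ = 1 := by
    have := Matrix.mem_unitaryGroup_iff.mp A.2
    rwa [Matrix.star_eq_conjTranspose] at this
  have hB : (B : Matrix (Fin s) (Fin s) ℂ) * (B : Matrix (Fin s) (Fin s) ℂ)ᴴ = 1 := by
    have := Matrix.mem_unitaryGroup_iff.mp B.2
    rwa [Matrix.star_eq_conjTranspose] at this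
  rw [Matrix.reindex_apply, Matrix.conjTranspose_submatrix, Matrix.submatrix_mul_equiv,
    Matrix.fromBlocks_conjTranspose, Matrix.fromBlocks_multiply]
  simp only [Matrix.conjTranspose_zero, Matrix.mul_zero, Matrix.zero_mul, add_zero, zero_add, hA, hB,
    Matrix.fromBlocks_one, Matrix.submatrix_one_equiv]

/-- The block-diagonal embedding `U(r) × U(s) → U(r+s)`, `(A, B) ↦ reindex (fromBlocks A 0 0 B)` — the stabiliser of `headProj r s`.
Object of stub S6 (Grassmannian net) of the v7 architecture of stmt-QuantumFields-27724. -/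
def blockDiag₂ {r s : ℕ} (A : Matrix.unitaryGroup (Fin r) ℂ) (B : Matrix.unitaryGroup (Fin s) ℂ) :
    Matrix.unitaryGroup (Fin (r + s)) ℂ :=
  ⟨Matrix.reindex finSumFinEquiv finSumFinEquiv
      (Matrix.fromBlocks (A : Matrix (Fin r) (Fin r) ℂ) 0 0 (B : Matrix (Fin s) (Fin s) ℂ)),
    reindex_fromBlocks_mem_unitaryGroup A B⟩

/-- The matrix of `blockDiag₂ A B`. -/
theorem coe_blockDiag₂ {r s : ℕ} (A : Matrix.unitaryGroup (Fin r) ℂ) (B : Matrix.unitaryGroup (Fin s) ℂ) :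
    ((blockDiag₂ A B : Matrix.unitaryGroup (Fin (r + s)) ℂ) : Matrix (Fin (r + s)) (Fin (r + s)) ℂ) =
      Matrix.reindex finSumFinEquiv finSumFinEquiv
        (Matrix.fromBlocks (A : Matrix (Fin r) (Fin r) ℂ) 0 0 (B : Matrix (Fin s) (Fin s) ℂ)) := rfl

end Summit.QuantumFields.YangMills.Theorems.EguchiKawaiDirectionLadder

end
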